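import Literature.Topology.FourManifolds.OrientedConnectedSumUniqueness
import Literature.Topology.FourManifolds.StraightenableIsotopy
import Literature.Topology.FourManifolds.OrientationDiffeotopy
import Literature.Topology.FourManifolds.Homogeneity
import Literature.Topology.FourManifolds.HalfDiscFromChart
import HarnessLib

/-!
# The disc theorem with a compactly supported diffeotopy to the identity

Topic `Literature/Topology/FourManifolds` (fact seat
`provefact-Literature.Topology.FourManifolds.IsHandlebody.exists_isBoundaryGluing_sphere`, step F2b of
the Lickorish–Wallace DAG; third layer of the *isotopy-tracked* disc theorem used by the
handle-extension step of the classification of handlebodies).  Everything here is **proved**;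
no named facts.

`OrientedConnectedSumUniqueness.lean` proves the oriented disc theorem
(`Literature.Topology.FourManifolds.exists_diffeomorph_apply_disc_eq`; Palais 1960, Thm. B;
Hirsch, *Differential Topology* (1976), Ch. 8 §3, Thm. 3.1): two equally oriented discs
`i, i' : ℝⁿ → M` in a connected `n`-manifold agree on the unit ball after a diffeomorphism `f`
of `M` preserving all orientations.  Hirsch's theorem says more — "an isotopy between them can
be realized by a **diffeotopy** of `M`", which moreover has **compact support inside any
connected open set `W` containing both discs** (Hirsch 1976, Ch. 8 §1, Thms. 1.3–1.4: isotopies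
of compacta extend to diffeotopies with compact support in a prescribed neighbourhood).  Both
refinements are what an application needs when `f` has to be extended over a collar
(`CollarExtension.lean`) or must leave a second disc untouched.  The same proof gives them, once
every building block carries its supported diffeotopy: the point push (`Homogeneity.lean`),
the straightening of `DF(0) ∈ GL⁺` (`StraightenableIsotopy.lean`), the local straightening of
a map tangent to the identity (`NearIdentityIsotopy.lean`) and the chart transport of compactly
supported diffeotopies (`DiffeotopyTransport.lean`).

* `Literature.Topology.FourManifolds.Diffeomorph.IsCompactlyDiffeotopicToIdIn W φ` — `φ` is
  the time-`1` stage of a diffeotopy all of whose stages are the identity off a compact subset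
  of `W` (a group under composition: `refl`, `trans`, `symm`, `mono`);
* `isCompactlyDiffeotopicToIdIn_chartTransportDiffeomorph` — chart transports of compactly
  diffeotopic diffeomorphisms of the model are compactly diffeotopic to the identity in any
  `W ⊇` the chart domain;
* `Diffeomorph.exists_isCompactlyDiffeotopicToIdIn_apply_eq` — homogeneity inside a connected
  open `W` (Hirsch 1976, Ch. 8 §3, Thm. 3.1, `k = 0`);
* `exists_isCompactlyDiffeotopicToIdIn_apply_disc_eq_disc_smul`, `…_apply_disc_eq_local`,
  `…_apply_disc_eq` — contraction, local and global disc theorem with `f` compactly diffeotopic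
  to the identity in `W`; `exists_isDiffeotopicToId_apply_disc_eq` — the case `W = M`.

## References

* R. Palais, *Extending diffeomorphisms*, Proc. AMS 11 (1960), Thm. B. [Palais1960]
* M. W. Hirsch, *Differential Topology*, GTM 33 (1976), Ch. 8 §1 (Thms. 1.3–1.4) and §3,
  Thm. 3.1. [HirschDT1976]
-/

open scoped Manifold ContDiff Topology
open Set Module Function Filter OpenPartialHomeomorph Metric

noncomputable section

namespace Literature.Topology.FourManifolds

/-! ### Diffeomorphisms compactly diffeotopic to the identity inside an open set -/

section Supported

variable {EN HN : Type*} [NormedAddCommGroup EN] [NormedSpace ℝ EN] [TopologicalSpace HN]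
  {J : ModelWithCorners ℝ EN HN} {N : Type*} [TopologicalSpace N] [ChartedSpace HN N]

/-- `φ` is **compactly diffeotopic to the identity inside `W`**: `φ` is the time-`1` stage of a
diffeotopy of `N` all of whose stages are the identity off some compact `K ⊆ W` (Hirsch 1976,
Ch. 8 §1: diffeotopies with compact support). [cite: HirschDT1976, Ch. 8 §1, p. 178] -/
def Diffeomorph.IsCompactlyDiffeotopicToIdIn (W : Set N) (φ : N ≃ₘ⟮J, J⟯ N) : Prop :=
  ∃ (D : Diffeotopy J N) (K : Set N), IsCompact K ∧ K ⊆ W ∧ D.stage 1 = φ ∧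
    ∀ t x, x ∉ K → D.toFun t x = x

namespace Diffeomorph.IsCompactlyDiffeotopicToIdIn

variable {W W' : Set N} {φ ψ : N ≃ₘ⟮J, J⟯ N}

/-- Forgetting the support. [folklore] -/
theorem isDiffeotopicToId (h : IsCompactlyDiffeotopicToIdIn W φ) : Diffeomorph.IsDiffeotopicToId φ := by
  obtain ⟨D, -, -, -, hD, -⟩ := h
  exact ⟨D, hD⟩

/-- Monotonicity in `W`. [folklore] -/
theorem mono (h : IsCompactlyDiffeotopicToIdIn W φ) (hW : W ⊆ W') : IsCompactlyDiffeotopicToIdIn W' φ := by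
  obtain ⟨D, K, hK, hKW, hD, hDK⟩ := h
  exact ⟨D, K, hK, hKW.trans hW, hD, hDK⟩

/-- Off `W` such a diffeomorphism is the identity. [folklore] -/
theorem apply_eq_self (h : IsCompactlyDiffeotopicToIdIn W φ) {x : N} (hx : x ∉ W) : φ x = x := by
  obtain ⟨D, K, -, hKW, hD, hDK⟩ := h
  rw [← hD, Diffeotopy.coe_stage]
  exact hDK 1 x fun hxK => hx (hKW hxK)

variable (W) in
/-- The identity is compactly diffeotopic to the identity inside any `W`. [folklore] -/
theorem refl : IsCompactlyDiffeotopicToIdIn W (Diffeomorph.refl J N ∞) :=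
  ⟨Diffeotopy.refl J N, ∅, isCompact_empty, empty_subset _, Diffeomorph.ext fun _ => rfl,
    fun _ _ _ => rfl⟩

/-- Closure under composition (compose stagewise; supports unite). [folklore] -/
theorem trans (hφ : IsCompactlyDiffeotopicToIdIn W φ) (hψ : IsCompactlyDiffeotopicToIdIn W ψ) :
    IsCompactlyDiffeotopicToIdIn W (φ.trans ψ) := by
  obtain ⟨D, K, hK, hKW, hD, hDK⟩ := hφ
  obtain ⟨D', K', hK', hK'W, hD', hDK'⟩ := hψ
  refine ⟨D.trans D', K ∪ K', hK.union hK', union_subset hKW hK'W, Diffeomorph.ext fun x => ?_,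
    fun t x hx => ?_⟩
  · rw [Diffeotopy.coe_stage, Diffeotopy.trans_toFun, Diffeomorph.coe_trans, Function.comp_apply,
      Function.comp_apply, ← Diffeotopy.coe_stage, ← Diffeotopy.coe_stage, hD, hD']
  · rw [Diffeotopy.trans_toFun, Function.comp_apply, hDK t x fun h => hx (Or.inl h),
      hDK' t x fun h => hx (Or.inr h)]

/-- Closure under inverses (invert stagewise). [folklore] -/
theorem symm (hφ : IsCompactlyDiffeotopicToIdIn W φ) : IsCompactlyDiffeotopicToIdIn W φ.symm := by
  obtain ⟨D, K, hK, hKW, hD, hDK⟩ := hφ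
  refine ⟨D.inv, K, hK, hKW, Diffeomorph.ext fun x => ?_, fun t x hx => ?_⟩
  · rw [Diffeotopy.coe_stage, Diffeotopy.inv_toFun, ← hD, Diffeotopy.coe_stage_symm]
  · rw [Diffeotopy.inv_toFun]
    conv_lhs => rw [← hDK t x hx]
    exact D.invFun_toFun t x

end Diffeomorph.IsCompactlyDiffeotopicToIdIn

end Supported

/-! ### Chart transports and point pushes with support -/

section Transport

variable {E : Type*} [NormedAddCommGroup E] [NormedSpace ℝ E] {M : Type*} [TopologicalSpace M]
  [T2Space M] [ChartedSpace E M] {φ : OpenPartialHomeomorph M E}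

/-- **Chart transports of compactly diffeotopic diffeomorphisms of the model are compactly
diffeotopic to the identity inside any `W` containing the chart domain** (transport the
diffeotopy, `Diffeotopy.chartTransport`; its support is `φ⁻¹(B̄(0, R'))`).
[cite: HirschDT1976, Ch. 8 §1, Thms. 1.3–1.4] -/
theorem isCompactlyDiffeotopicToIdIn_chartTransportDiffeomorph [ProperSpace E]
    (hφ : ContMDiffOn 𝓘(ℝ, E) 𝓘(ℝ, E) ∞ φ φ.source)
    (hφ' : ContMDiff 𝓘(ℝ, E) 𝓘(ℝ, E) ∞ φ.symm) (htarget : φ.target = univ)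
    (s : E ≃ₘ⟮𝓘(ℝ, E), 𝓘(ℝ, E)⟯ E) {R : ℝ} (hs : ∀ y, R ≤ ‖y‖ → s y = y)
    (hsD : ∃ D : Diffeotopy 𝓘(ℝ, E) E, D.stage 1 = s ∧ ∃ R', ∀ t y, R' ≤ ‖y‖ → D.toFun t y = y)
    {W : Set M} (hW : φ.source ⊆ W) :
    Diffeomorph.IsCompactlyDiffeotopicToIdIn W (chartTransportDiffeomorph hφ hφ' htarget s hs) := by
  obtain ⟨D, hD1, R', hD⟩ := hsD
  refine ⟨D.chartTransport hφ hφ' htarget hD, φ.symm '' closedBall (0 : E) R',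
    (isCompact_closedBall _ _).image hφ'.continuous, ?_, Diffeomorph.ext fun x => ?_,
    fun t x hx => Diffeotopy.chartTransport_toFun_eq_self hφ hφ' htarget D hD t hx⟩
  · rintro _ ⟨y, -, rfl⟩
    exact hW (φ.map_target (by rw [htarget]; trivial))
  · change chartTransport φ (D.toFun 1) x = chartTransport φ s x
    rw [← Diffeotopy.coe_stage, hD1]

end Transport

section PointPush

variable {n : ℕ}

/-- Local notation: `𝔼 n` is the model Euclidean space `EuclideanSpace ℝ (Fin n)`. -/
local notation "𝔼 " n:arg => EuclideanSpace ℝ (Fin n)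

variable {M : Type*} [TopologicalSpace M] [ChartedSpace (𝔼 n) M] [IsManifold (𝓡 n) ∞ M]

/-- Every neighbourhood `U` of a point `x` contains the source of a chart of the maximal atlas
**centred at `x`** (`e x = 0`) whose target is all of `ℝⁿ` (same construction as
`exists_mem_maximalAtlas_target_eq_univ_source_subset`, recording the centre). [folklore] -/
theorem exists_mem_maximalAtlas_target_eq_univ_source_subset_apply_eq_zero (x : M) {U : Set M}
    (hU : U ∈ 𝓝 x) :
    ∃ e ∈ IsManifold.maximalAtlas (𝓡 n) ∞ M, x ∈ e.source ∧ e.source ⊆ U ∧ e.target = univ ∧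
      e x = 0 := by
  obtain ⟨U', hU'U, hU'o, hxU'⟩ := mem_nhds_iff.1 hU
  set e₀ := chartAt (𝔼 n) x
  have hV : IsOpen (e₀.target ∩ e₀.symm ⁻¹' U') := e₀.isOpen_inter_preimage_symm hU'o
  have hxV : e₀ x ∈ e₀.target ∩ e₀.symm ⁻¹' U' :=
    ⟨mem_chart_target _ x, by rw [mem_preimage, e₀.left_inv (mem_chart_source _ x)]; exact hxU'⟩
  obtain ⟨r, hr, hball⟩ := Metric.isOpen_iff.1 hV (e₀ x) hxV
  set u := univBall (e₀ x) r
  have hut : u.target = Metric.ball (e₀ x) r := univBall_target _ hr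
  have h₀ := IsManifold.chart_mem_maximalAtlas (I := 𝓡 n) (n := ∞) x
  refine ⟨e₀ ≫ₕ u.symm, ?_, ?_, ?_, ?_, ?_⟩
  · apply OpenPartialHomeomorph.mem_maximalAtlas_of_contMDiffOn
    · rw [trans_source, coe_trans, symm_source, hut]
      exact contDiffOn_univBall_symm.contMDiffOn.comp
        ((contMDiffOn_of_mem_maximalAtlas h₀).mono inter_subset_left) fun y hy => hy.2
    · rw [trans_symm_eq_symm_trans_symm, symm_symm]
      exact (contMDiffOn_symm_of_mem_maximalAtlas h₀).comp contDiff_univBall.contMDiff.contMDiffOn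
        fun y hy => hy.2
  · simp only [trans_source, symm_source, hut, mem_inter_iff, mem_chart_source, mem_preimage,
      Metric.mem_ball_self hr, and_self, e₀]
  · intro y hy
    rw [trans_source, symm_source, hut] at hy
    have hy' : e₀ y ∈ e₀.target ∩ e₀.symm ⁻¹' U' := hball hy.2
    have := hy'.2
    rw [mem_preimage, e₀.left_inv hy.1] at this
    exact hU'U this
  · rw [trans_target, symm_target, univBall_source, univ_inter, eq_univ_iff_forall]
    intro y
    exact (hball (hut ▸ u.map_source (by simp [u]))).1
  · rw [coe_trans, Function.comp_apply]
    exact univBall_symm_apply_center _ _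

variable [T2Space M]

/-- **Homogeneity inside a connected open set, by compactly supported diffeotopies**: for
`x, y` in a preconnected open `W ⊆ M` there is a diffeomorphism `P` of `M`, compactly diffeotopic
to the identity inside `W`, with `P x = y` — chains of translation pushes transported along
full-target charts whose domains lie in `W` (Hirsch 1976, Ch. 8 §3, Thm. 3.1 for `k = 0`, with
Ch. 8 §1, Thms. 1.3–1.4 for the support). [cite: HirschDT1976, Ch. 8 §3, Thm. 3.1 (k = 0)] -/
theorem Diffeomorph.exists_isCompactlyDiffeotopicToIdIn_apply_eq {W : Set M} (hWo : IsOpen W)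
    (hWc : IsPreconnected W) {x y : M} (hx : x ∈ W) (hy : y ∈ W) :
    ∃ P : M ≃ₘ⟮𝓡 n, 𝓡 n⟯ M, Diffeomorph.IsCompactlyDiffeotopicToIdIn W P ∧ P x = y := by
  let Rel : M → M → Prop := fun a b =>
    ∃ P : M ≃ₘ⟮𝓡 n, 𝓡 n⟯ M, Diffeomorph.IsCompactlyDiffeotopicToIdIn W P ∧ P a = b
  refine hWc.induction₂ Rel (fun a ha => ?_) (fun a b c _ _ _ ⟨P, hP, hPa⟩ ⟨Q, hQ, hQb⟩ =>
    ⟨P.trans Q, hP.trans hQ, by simp [Diffeomorph.coe_trans, hPa, hQb]⟩)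
    (fun a b _ _ ⟨P, hP, hPa⟩ => ⟨P.symm, hP.symm, by rw [← hPa, P.symm_apply_apply]⟩) hx hy
  obtain ⟨e, he, hae, heW, htarget, hea⟩ :=
    exists_mem_maximalAtlas_target_eq_univ_source_subset_apply_eq_zero (n := n) a (hWo.mem_nhds ha)
  have hφ : ContMDiffOn 𝓘(ℝ, 𝔼 n) 𝓘(ℝ, 𝔼 n) ∞ e e.source := contMDiffOn_of_mem_maximalAtlas he
  have hφ' : ContMDiff 𝓘(ℝ, 𝔼 n) 𝓘(ℝ, 𝔼 n) ∞ e.symm := by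
    have h := contMDiffOn_symm_of_mem_maximalAtlas he
    rwa [htarget, contMDiffOn_univ] at h
  have hU : e.source ∩ e ⁻¹' ball (0 : 𝔼 n) (pushRadius (𝔼 n)) ∈ 𝓝[W] a :=
    mem_nhdsWithin_of_mem_nhds ((e.isOpen_inter_preimage isOpen_ball).mem_nhds
      ⟨hae, by simp [hea, pushRadius_pos]⟩)
  filter_upwards [hU] with b hb
  have hv : ‖e b‖ ≤ pushRadius (𝔼 n) := by simpa using (le_of_lt (mem_ball_zero_iff.mp hb.2))
  let G : AmbientIsotopy 𝓘(ℝ, 𝔼 n) M := (translationPush hv).alongChart hφ hφ' htarget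
    (R := 2) (fun t z hz => translationPushFun_eq_self (e b) t hz)
  refine ⟨G.toDiffeomorph 1, ⟨G.toDiffeotopy, e.symm '' closedBall (0 : 𝔼 n) 2,
    (isCompact_closedBall _ _).image hφ'.continuous, ?_, (G.toDiffeotopy_stage 1), fun t z hz => ?_⟩, ?_⟩
  · rintro _ ⟨w, -, rfl⟩
    exact heW (e.map_target (by rw [htarget]; trivial))
  · change chartTransport e (translationPushFun (e b) t) z = z
    exact chartTransport_eq_self (fun w hw => translationPushFun_eq_self (e b) t hw) hz
  · change chartTransport e (translationPushFun (e b) 1) a = b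
    rw [chartTransport_of_mem _ hae, hea, translationPushFun_one_apply_zero, e.left_inv hb.1]

end PointPush

/-! ### The disc theorem -/

section DiscTheorem

variable {n : ℕ}

/-- Local notation: `𝔼 n` is the model Euclidean space `EuclideanSpace ℝ (Fin n)`. -/
local notation "𝔼 " n:arg => EuclideanSpace ℝ (Fin n)

variable {M : Type*} [TopologicalSpace M] [T2Space M] [ChartedSpace (𝔼 n) M]
  [IsManifold (𝓡 n) ∞ M]

omit [IsManifold (𝓡 n) ∞ M] in
/-- **Ambient contraction of a disc by a diffeomorphism compactly diffeotopic to the identity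
inside any `W ⊇ range i`.**  For a disc `i : ℝⁿ → M` and `0 < ρ` there is such a `K` with
`K (i y) = i (ρ y)` for `‖y‖ ≤ 1` (transport along the chart `i⁻¹` the compactly diffeotopic
straightening of the homothety `ρ •`, `IsStraightenableIso.smul_id`). Hirsch (1976), Ch. 8 §3,
proof of Thm. 3.1 (shrinking the discs). [cite: HirschDT1976, Ch. 8 §3, proof of Thm. 3.1] -/
theorem exists_isCompactlyDiffeotopicToIdIn_apply_disc_eq_disc_smul {i : 𝔼 n → M}
    (hi : Manifold.IsSmoothEmbedding 𝓘(ℝ, 𝔼 n) (𝓡 n) ∞ i) {ρ : ℝ} (hρ : 0 < ρ) {W : Set M}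
    (hW : range i ⊆ W) :
    ∃ K : M ≃ₘ⟮𝓡 n, 𝓡 n⟯ M, Diffeomorph.IsCompactlyDiffeotopicToIdIn W K ∧
      ∀ y : 𝔼 n, ‖y‖ ≤ 1 → K (i y) = i (ρ • y) := by
  obtain ⟨Φ, hΦt, hΦs, hΦsrc, hΦc⟩ := exists_chart_of_isSmoothEmbedding hi
  obtain ⟨c, R, hc1, hc2, D, hD1, hD2⟩ :=
    (IsStraightenableIso.smul_id (E := 𝔼 n) hρ).exists_eq_on_closedBall
  have hΦ' : ContMDiff (𝓡 n) (𝓡 n) ∞ Φ.symm := by rw [hΦs]; exact hi.contMDiff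
  refine ⟨chartTransportDiffeomorph hΦc hΦ' hΦt c hc2,
    isCompactlyDiffeotopicToIdIn_chartTransportDiffeomorph hΦc hΦ' hΦt c hc2 ⟨D, hD1, R, hD2⟩
      (fun x hx => hW (by rwa [hΦsrc] at hx)), fun y hy => ?_⟩
  have h := chartTransportDiffeomorph_symm_apply hΦc hΦ' hΦt c hc2 y
  rw [hΦs] at h
  rw [h, hc1 y hy]
  rfl

/-- **Local disc theorem, with a compactly supported diffeotopy to the identity.**  Two discs
`i, i' : ℝⁿ → M` which both preserve the orientations `(o₀, oM)` and lie in a preconnected open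
`W` agree on a small ball, `f (i y) = i' y` for `‖y‖ ≤ ρ`, after a diffeomorphism `f` of `M`
compactly diffeotopic to the identity inside `W`.  Hirsch (1976), Ch. 8 §3, proof of Thm. 3.1,
every step realised by a diffeotopy supported in `W`: move `i 0` to `i' 0` by point pushes in
`W`; in the chart `Φ' = (i')⁻¹` (domain `range i' ⊆ W`), `F = Φ' ∘ f₁ ∘ i` has `DF(0) ∈ GL⁺`,
straightened by a compactly diffeotopic `s` (`isStraightenableIso_of_det_pos`); `s⁻¹ ∘ F` is
tangent to the identity and agrees near `0` with a compactly diffeotopic `G`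
(`exists_diffeomorph_diffeotopy_eq_of_fderiv_eq_id`); transport `s ∘ G` and its diffeotopy
back along `Φ'`. [cite: HirschDT1976, Ch. 8 §3, Thm. 3.1] -/
theorem exists_isCompactlyDiffeotopicToIdIn_apply_disc_eq_local {i i' : 𝔼 n → M}
    (hi : Manifold.IsSmoothEmbedding 𝓘(ℝ, 𝔼 n) (𝓡 n) ∞ i)
    (hi' : Manifold.IsSmoothEmbedding 𝓘(ℝ, 𝔼 n) (𝓡 n) ∞ i')
    {o₀ : Orientation ℝ (𝔼 n) (Fin (finrank ℝ (𝔼 n)))} {oM : SmoothOrientation (𝓡 n) M}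
    (ho : IsOrientationPreserving (SmoothOrientation.modelSpace o₀) oM i)
    (ho' : IsOrientationPreserving (SmoothOrientation.modelSpace o₀) oM i')
    {W : Set M} (hWo : IsOpen W) (hWc : IsPreconnected W) (hiW : range i ⊆ W) (hi'W : range i' ⊆ W) :
    ∃ f : M ≃ₘ⟮𝓡 n, 𝓡 n⟯ M, Diffeomorph.IsCompactlyDiffeotopicToIdIn W f ∧
      ∃ ρ > (0 : ℝ), ∀ y : 𝔼 n, ‖y‖ ≤ ρ → f (i y) = i' y := by
  -- Step 1: move the centre inside `W`
  obtain ⟨f₁, hf₁d, hf₁⟩ := Diffeomorph.exists_isCompactlyDiffeotopicToIdIn_apply_eq (n := n) hWo hWc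
    (hiW (mem_range_self 0)) (hi'W (mem_range_self 0))
  have hf₁o : ∀ oM' : SmoothOrientation (𝓡 n) M, f₁.IsOrientationPreserving oM' oM' := fun oM' =>
    hf₁d.isDiffeotopicToId.isOrientationPreserving oM'
  set i₁ : 𝔼 n → M := f₁ ∘ i with hi₁_def
  have hi₁ : Manifold.IsSmoothEmbedding 𝓘(ℝ, 𝔼 n) (𝓡 n) ∞ i₁ := hi.diffeomorph_comp f₁
  have hi₁0 : i₁ 0 = i' 0 := hf₁
  have ho₁ : IsOrientationPreserving (SmoothOrientation.modelSpace o₀) oM i₁ :=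
    IsOrientationPreserving.comp_holds (hf₁o oM) ho (f₁.mdifferentiable (by simp))
      (fun y => (hi.contMDiff y).mdifferentiableAt (by simp))
      (fun x => f₁.det_mfderiv_ne_zero (by simp) x)
      (fun y => det_mfderiv_ne_zero_of_isSmoothEmbedding hi (isOpen_range_of_isSmoothEmbedding_disc hi) y)
  -- Step 2: the chart `Φ' = (i')⁻¹`
  obtain ⟨Φ, hΦt, hΦs, hΦsrc, hΦc⟩ := exists_chart_of_isSmoothEmbedding hi'
  have hΦ' : ContMDiff (𝓡 n) (𝓡 n) ∞ Φ.symm := by rw [hΦs]; exact hi'.contMDiff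
  have hoΦ : IsOrientationPreserving (SmoothOrientation.modelSpace o₀) oM Φ.symm := by
    rw [hΦs]; exact ho'
  have h0src : i₁ 0 ∈ Φ.source := by rw [hi₁0, hΦsrc]; exact mem_range_self 0
  have hΦ0 : Φ (i₁ 0) = 0 := by
    rw [hi₁0, ← hΦs]; exact Φ.right_inv (by rw [hΦt]; trivial)
  -- Step 3: the local map `F = Φ ∘ i₁`
  set V : Set (𝔼 n) := i₁ ⁻¹' Φ.source with hV_def
  have hV : IsOpen V := Φ.open_source.preimage hi₁.contMDiff.continuous
  have h0V : (0 : 𝔼 n) ∈ V := h0src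
  set F : (𝔼 n) → (𝔼 n) := Φ ∘ i₁ with hF_def
  have hFs : ContMDiffOn (𝓡 n) (𝓡 n) ∞ F V :=
    hΦc.comp hi₁.contMDiff.contMDiffOn fun y hy => hy
  have hFc : ContDiffOn ℝ ∞ F V := contMDiffOn_iff_contDiffOn.mp hFs
  have hF0 : F 0 = 0 := hΦ0
  have hFd : DifferentiableAt ℝ F 0 := (hFc.contDiffAt (hV.mem_nhds h0V)).differentiableAt (by simp)
  set L : (𝔼 n) →L[ℝ] (𝔼 n) := fderiv ℝ F 0 with hL_def
  -- `det L > 0`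
  have hL : 0 < LinearMap.det (L : (𝔼 n) →ₗ[ℝ] (𝔼 n)) := by
    obtain ⟨hΦo, hΦd, hΦ0'⟩ := orientationAt_chart hΦc hΦ' hΦt hoΦ h0src
    have hc := orientationAt_comp (oM := SmoothOrientation.modelSpace o₀) (oN := oM)
      (oP := SmoothOrientation.modelSpace o₀) (f := i₁) (g := Φ) (x := (0 : 𝔼 n))
      ((hi₁.contMDiff 0).mdifferentiableAt (by simp)) hΦd
      (det_mfderiv_ne_zero_of_isSmoothEmbedding hi₁ (isOpen_range_of_isSmoothEmbedding_disc hi₁) 0)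
      hΦ0' (ho₁ 0) hΦo
    simp only [SmoothOrientation.modelSpace_apply, true_iff] at hc
    rwa [mfderiv_eq_fderiv] at hc
  -- Step 4: straighten `L` by a compactly diffeotopic `s`
  set Le : (𝔼 n) ≃L[ℝ] (𝔼 n) := L.toContinuousLinearEquivOfDetNeZero hL.ne' with hLe_def
  have hLe : (Le : (𝔼 n) →L[ℝ] (𝔼 n)) = L := L.coe_toContinuousLinearEquivOfDetNeZero hL.ne'
  obtain ⟨s, ρ₁, R₁, hρ₁, hs1, hs2, Ds, hDs1, hDs2⟩ :=
    isStraightenableIso_of_det_pos Le (by rw [hLe]; exact hL)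
  have hs0 : s 0 = 0 := by rw [hs1 0 (by simp [hρ₁.le])]; simp
  have hs'0 : s.symm 0 = 0 := by
    have h := s.symm_apply_apply 0
    rwa [hs0] at h
  have hsL : HasFDerivAt s L 0 := by
    have hev : (s : 𝔼 n → 𝔼 n) =ᶠ[𝓝 0] Le := by
      filter_upwards [closedBall_mem_nhds (0 : 𝔼 n) hρ₁] with y hy
      exact hs1 y (by simpa using hy)
    rw [← hLe]
    exact (Le : (𝔼 n) →L[ℝ] (𝔼 n)).hasFDerivAt.congr_of_eventuallyEq hev
  have hs'd : DifferentiableAt ℝ s.symm 0 := (s.symm.contMDiff.contDiff.differentiable (by simp)) 0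
  have hinv : (fderiv ℝ s.symm 0).comp L = ContinuousLinearMap.id ℝ (𝔼 n) := by
    have h1 : HasFDerivAt (s.symm ∘ s) ((fderiv ℝ s.symm 0).comp L) 0 := by
      have h : HasFDerivAt s.symm (fderiv ℝ s.symm 0) (s 0) := by
        rw [hs0]; exact hs'd.hasFDerivAt
      exact h.comp 0 hsL
    have h2 : (s.symm : 𝔼 n → 𝔼 n) ∘ s = id := funext fun y => s.symm_apply_apply y
    rw [h2] at h1
    exact h1.unique (hasFDerivAt_id 0)
  -- Step 5: `s⁻¹ ∘ F` is tangent to the identity; straighten it by a compactly diffeotopic `G`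
  set F₂ : (𝔼 n) → (𝔼 n) := s.symm ∘ F with hF₂_def
  have hF₂c : ContDiffOn ℝ ∞ F₂ V := s.symm.contMDiff.contDiff.comp_contDiffOn hFc
  have hF₂0 : F₂ 0 = 0 := by simp [hF₂_def, hF0, hs'0]
  have hDF₂ : fderiv ℝ F₂ 0 = ContinuousLinearMap.id ℝ (𝔼 n) := by
    have h : HasFDerivAt s.symm (fderiv ℝ s.symm 0) (F 0) := by
      rw [hF0]; exact hs'd.hasFDerivAt
    have h2 : HasFDerivAt F₂ ((fderiv ℝ s.symm 0).comp L) 0 := h.comp 0 hFd.hasFDerivAt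
    rw [h2.fderiv, hinv]
  obtain ⟨r, hr, hrV, G, DG, hG1, hG2, hDG1, hDG2⟩ :=
    exists_diffeomorph_diffeotopy_eq_of_fderiv_eq_id hV h0V hF₂c hF₂0 hDF₂
  have hFG : ∀ y : 𝔼 n, ‖y‖ ≤ r → F y = s (G y) := fun y hy => by
    rw [hG1 y (by simpa using hy)]
    simp [hF₂_def]
  -- Step 6: transport `T = s ∘ G` and its diffeotopy along `Φ`
  set T := G.trans s with hT_def
  have hT : ∀ y : 𝔼 n, max (2 * r) R₁ ≤ ‖y‖ → T y = y := fun y hy => by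
    show s (G y) = y
    rw [hG2 y ((le_max_left _ _).trans hy), hs2 y ((le_max_right _ _).trans hy)]
  have hTD : ∃ D : Diffeotopy 𝓘(ℝ, 𝔼 n) (𝔼 n), D.stage 1 = T ∧
      ∃ R', ∀ t y, R' ≤ ‖y‖ → D.toFun t y = y := by
    refine ⟨DG.trans Ds, Diffeomorph.ext fun y => ?_, max (2 * r) R₁, fun t y hy => ?_⟩
    · rw [Diffeotopy.coe_stage, Diffeotopy.trans_toFun, hT_def, Diffeomorph.coe_trans,
        Function.comp_apply, Function.comp_apply, ← Diffeotopy.coe_stage, ← Diffeotopy.coe_stage,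
        hDG1, hDs1]
    · rw [Diffeotopy.trans_toFun, Function.comp_apply, hDG2 t y ((le_max_left _ _).trans hy),
        hDs2 t y ((le_max_right _ _).trans hy)]
  set H := chartTransportDiffeomorph hΦc hΦ' hΦt T hT with hH_def
  have hHd : Diffeomorph.IsCompactlyDiffeotopicToIdIn W H :=
    isCompactlyDiffeotopicToIdIn_chartTransportDiffeomorph hΦc hΦ' hΦt T hT hTD
      (fun x hx => hi'W (by rwa [hΦsrc] at hx))
  have hHi : ∀ y : 𝔼 n, ‖y‖ ≤ r → H (i' y) = i₁ y := fun y hy => by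
    have h := chartTransportDiffeomorph_symm_apply hΦc hΦ' hΦt T hT y
    have e1 : Φ.symm y = i' y := by rw [hΦs]
    rw [e1] at h
    rw [h]
    show Φ.symm (s (G y)) = i₁ y
    rw [← hFG y hy]
    exact Φ.left_inv (hrV (by simp; linarith [hy]))
  -- Step 7: `f = H⁻¹ ∘ f₁`
  refine ⟨f₁.trans H.symm, hf₁d.trans hHd.symm, r, hr, fun y hy => ?_⟩
  show H.symm (f₁ (i y)) = i' y
  rw [show f₁ (i y) = i₁ y from rfl, ← hHi y hy, H.symm_apply_apply]

/-- **The disc theorem with a compactly supported diffeotopy to the identity** (Palais 1960,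
Thm. B; Hirsch, *Differential Topology* (1976), Ch. 8 §3, Thm. 3.1: "`f` and `g` are isotopic
[and] an isotopy between them can be realized by a diffeotopy of `M`", with support in a
neighbourhood by Ch. 8 §1, Thms. 1.3–1.4).  For two discs `i, i' : ℝⁿ → M` (smooth embeddings
of `ℝⁿ`) in a Hausdorff smooth `n`-manifold which both preserve the orientations `(o₀, oM)` and
lie in a preconnected open `W`, there is a diffeomorphism `f` of `M`, compactly diffeotopic to
the identity inside `W`, with `f (i y) = i' y` for all `‖y‖ ≤ 1`.
[cite: Palais1960, Thm. B] [cite: HirschDT1976, Ch. 8 §3, Thm. 3.1] -/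
theorem exists_isCompactlyDiffeotopicToIdIn_apply_disc_eq {i i' : 𝔼 n → M}
    (hi : Manifold.IsSmoothEmbedding 𝓘(ℝ, 𝔼 n) (𝓡 n) ∞ i)
    (hi' : Manifold.IsSmoothEmbedding 𝓘(ℝ, 𝔼 n) (𝓡 n) ∞ i')
    {o₀ : Orientation ℝ (𝔼 n) (Fin (finrank ℝ (𝔼 n)))} {oM : SmoothOrientation (𝓡 n) M}
    (ho : IsOrientationPreserving (SmoothOrientation.modelSpace o₀) oM i)
    (ho' : IsOrientationPreserving (SmoothOrientation.modelSpace o₀) oM i')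
    {W : Set M} (hWo : IsOpen W) (hWc : IsPreconnected W) (hiW : range i ⊆ W) (hi'W : range i' ⊆ W) :
    ∃ f : M ≃ₘ⟮𝓡 n, 𝓡 n⟯ M, Diffeomorph.IsCompactlyDiffeotopicToIdIn W f ∧
      ∀ y : 𝔼 n, ‖y‖ ≤ 1 → f (i y) = i' y := by
  obtain ⟨f₀, hf₀d, ρ, hρ, hf₀⟩ :=
    exists_isCompactlyDiffeotopicToIdIn_apply_disc_eq_local hi hi' ho ho' hWo hWc hiW hi'W
  set ρ' := min ρ 1 with hρ'_def
  have hρ' : 0 < ρ' := lt_min hρ one_pos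
  have hρ'ρ : ρ' ≤ ρ := min_le_left _ _
  obtain ⟨K, hKd, hK⟩ := exists_isCompactlyDiffeotopicToIdIn_apply_disc_eq_disc_smul hi hρ' hiW
  obtain ⟨K', hK'd, hK'⟩ := exists_isCompactlyDiffeotopicToIdIn_apply_disc_eq_disc_smul hi' hρ' hi'W
  refine ⟨K.trans (f₀.trans K'.symm), hKd.trans (hf₀d.trans hK'd.symm), fun y hy => ?_⟩
  show K'.symm (f₀ (K (i y))) = i' y
  have hρy : ‖ρ' • y‖ ≤ ρ := by
    rw [norm_smul, Real.norm_of_nonneg hρ'.le]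
    calc ρ' * ‖y‖ ≤ ρ' * 1 := by gcongr
      _ ≤ ρ := by rw [mul_one]; exact hρ'ρ
  rw [hK y hy, hf₀ _ hρy, ← hK' y hy, K'.symm_apply_apply]

/-- **The disc theorem with a diffeotopy to the identity** (the case `W = M` of
`exists_isCompactlyDiffeotopicToIdIn_apply_disc_eq`; Palais 1960, Thm. B; Hirsch 1976, Ch. 8
§3, Thm. 3.1): in a connected manifold two equally oriented discs agree on the unit ball after a
diffeomorphism diffeotopic to the identity. [cite: Palais1960, Thm. B] [cite: HirschDT1976, Ch. 8 §3, Thm. 3.1] -/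
theorem exists_isDiffeotopicToId_apply_disc_eq [ConnectedSpace M] {i i' : 𝔼 n → M}
    (hi : Manifold.IsSmoothEmbedding 𝓘(ℝ, 𝔼 n) (𝓡 n) ∞ i)
    (hi' : Manifold.IsSmoothEmbedding 𝓘(ℝ, 𝔼 n) (𝓡 n) ∞ i')
    {o₀ : Orientation ℝ (𝔼 n) (Fin (finrank ℝ (𝔼 n)))} {oM : SmoothOrientation (𝓡 n) M}
    (ho : IsOrientationPreserving (SmoothOrientation.modelSpace o₀) oM i)
    (ho' : IsOrientationPreserving (SmoothOrientation.modelSpace o₀) oM i') :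
    ∃ f : M ≃ₘ⟮𝓡 n, 𝓡 n⟯ M, Diffeomorph.IsDiffeotopicToId f ∧ ∀ y : 𝔼 n, ‖y‖ ≤ 1 → f (i y) = i' y := by
  obtain ⟨f, hf, hf'⟩ := exists_isCompactlyDiffeotopicToIdIn_apply_disc_eq hi hi' ho ho' isOpen_univ
    isPreconnected_univ (subset_univ _) (subset_univ _)
  exact ⟨f, hf.isDiffeotopicToId, hf'⟩

end DiscTheorem

end Literature.Topology.FourManifolds
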